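import Summits.RiemannHypothesis.RiemannHypothesis.Theorems.PfPersistenceFfWeilCriterionSharpQ4
import Summits.RiemannHypothesis.RiemannHypothesis.Theorems.PfPersistenceFfHandoverRH

/-!
# Function-field mirror: sharpness of the positivity depth at the FIXED `q = 4` — all `g ≥ 1` (bounded `q`)
(pub-rhpf, seat ffmirror-2 gen 7; HONEST FRAMING: mechanism/rigidity campaign — no RH claims)

`PfPersistenceFfWeilCriterionSharpQ4.sharp_witness_q4` gives, for every `g ≥ 4`, a MONIC FE-honest RH-false
datum `(4, H_{g-1})` of degree `2g` whose window of depth `2g - 2` is positive semidefinite (depth `2g - 1` is not,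
by the finite Weil criterion).  This file supplies the three small genera at the SAME `q = 4` and assembles the
bounded-`q` form of door-D-D sharpness (ADJ-LOG A290 (A3) / ESCAPE-DOORS v1.17 rider R2):
* `g = 1`: `h₁ = x² - 5x + 4 = (x - 1)(x - 4)` (roots `1, 4`; `T_0 = (1) ⪰ 0`, `T_1` not PSD);
* `g = 2`: the landed `sharp_witness` (`h♯ = x⁴ - 5x³ + 8x² - 20x + 16`, `PfPersistenceFfWeilCriterionSharp`);
* `g = 3`: the member `H_2 = x⁶ - 2x⁵ - x⁴ - 4x² - 32x + 64` of the family, power sums `2, 6, 14, 50` by four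
  Newton steps, window `T_4 = Toeplitz(3, 1/2, 3/4, 7/8, 25/16) ⪰ 0` by an explicit `LDLᵀ` certificate
  (pivots `3, 35/12, 387/140, 112/43, 14509/7168`);
* `positivityDepth_sharp_q4` (`∀ g ≥ 1`, witness MONIC at `q = 4`) and `positivityDepth_sharp_bounded`
  (`∃ q ≤ 4` in the exact shape of `positivityDepth_sharp`): the positivity depth `2g - 1` of the finite Weil
  criterion is sharp UNIFORMLY IN `g` AT ONE PRIME POWER.  Nothing here is about `ζ`; 'RH' is the function-field
  statement `∀ α ∈ frobRoots h, ‖α‖ = √q` for the datum at hand; odd prime powers `q` remain open.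
-/

set_option linter.dupNamespace false  -- the mandated namespace repeats `RiemannHypothesis`

noncomputable section

open Polynomial Matrix Finset
open scoped ComplexOrder ComplexConjugate

namespace Summit.RiemannHypothesis.RiemannHypothesis.Theorems.PfPersistence.FfAngleTwin

/-! ## `g = 3`: the member `H_2` of the family (explicit `5 × 5` certificate) -/

/-- Vieta for `H_2` (degree `6`). [folklore] -/
theorem esymm_hQ4_two (k : ℕ) (hk : k ≤ 6) :
    (frobRoots (hQ4 2)).esymm k = (-1) ^ k * (((hQ4 2).coeff (6 - k) : ℤ) : ℂ) := by
  have h := esymm_frobRoots (hQ4_monic 2 le_rfl) (k := k) (by rw [natDegree_hQ4 2 le_rfl]; omega)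
  rwa [natDegree_hQ4 2 le_rfl] at h

/-- The power sums `s_1, s_2, s_3, s_4 = 2, 6, 14, 50` of the roots of `H_2`, by four Newton steps from
`e_1 = 2, e_2 = -1, e_3 = 0, e_4 = -4` (no root is computed). [folklore] -/
theorem powerSum_hQ4_two :
    powerSum (frobRoots (hQ4 2)) 1 = 2 ∧ powerSum (frobRoots (hQ4 2)) 2 = 6 ∧
    powerSum (frobRoots (hQ4 2)) 3 = 14 ∧ powerSum (frobRoots (hQ4 2)) 4 = 50 := by
  set A := frobRoots (hQ4 2) with hA
  have e0 : A.esymm 0 = 1 := multiset_esymm_zero A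
  have e1 : A.esymm 1 = 2 := by rw [esymm_hQ4_two 1 (by norm_num), coeff_hQ4]; norm_num
  have e2 : A.esymm 2 = -1 := by rw [esymm_hQ4_two 2 (by norm_num), coeff_hQ4]; norm_num
  have e3 : A.esymm 3 = 0 := by rw [esymm_hQ4_two 3 (by norm_num), coeff_hQ4]; norm_num
  have e4 : A.esymm 4 = -4 := by rw [esymm_hQ4_two 4 (by norm_num), coeff_hQ4]; norm_num
  have n1 := newton_range A 1
  have n2 := newton_range A 2
  have n3 := newton_range A 3
  have n4 := newton_range A 4
  simp only [sum_range_succ, sum_range_zero, zero_add, e0, e1, e2, e3, e4] at n1 n2 n3 n4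
  norm_num at n1 n2 n3 n4
  have s1 : powerSum A 1 = 2 := by linear_combination -n1
  have s2 : powerSum A 2 = 6 := by linear_combination n2 + 2 * s1
  have s3 : powerSum A 3 = 14 := by linear_combination -n3 + 2 * s2 + s1
  have s4 : powerSum A 4 = 50 := by linear_combination n4 + 2 * s3 + s2
  exact ⟨s1, s2, s3, s4⟩

/-- The window `T_4(4, H_2)` (size `5 = 2g - 1`): Toeplitz with symbol `(3, 1/2, 3/4, 7/8, 25/16)`. [folklore] -/
theorem windowForm_hQ4_two :
    ffWindowForm 4 (frobRoots (hQ4 2)) 4 =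
      !![3, 1 / 2, 3 / 4, 7 / 8, 25 / 16; 1 / 2, 3, 1 / 2, 3 / 4, 7 / 8; 3 / 4, 1 / 2, 3, 1 / 2, 3 / 4;
        7 / 8, 3 / 4, 1 / 2, 3, 1 / 2; 25 / 16, 7 / 8, 3 / 4, 1 / 2, 3] := by
  obtain ⟨s1, s2, s3, s4⟩ := powerSum_hQ4_two
  have k0 : ffKernel 4 (frobRoots (hQ4 2)) 0 = 3 := by
    rw [ffKernel_zero, card_frobRoots_eq_natDegree, natDegree_hQ4 2 le_rfl]; norm_num
  have k1 : ffKernel 4 (frobRoots (hQ4 2)) 1 = 1 / 2 := by rw [ffKernel_eq, s1, sqrt_four]; norm_num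
  have k2 : ffKernel 4 (frobRoots (hQ4 2)) 2 = 3 / 4 := by rw [ffKernel_eq, s2, sqrt_four]; norm_num
  have k3 : ffKernel 4 (frobRoots (hQ4 2)) 3 = 7 / 8 := by rw [ffKernel_eq, s3, sqrt_four]; norm_num
  have k4 : ffKernel 4 (frobRoots (hQ4 2)) 4 = 25 / 16 := by rw [ffKernel_eq, s4, sqrt_four]; norm_num
  ext m m'
  fin_cases m <;> fin_cases m' <;> simp [ffWindowForm, Nat.dist, k0, k1, k2, k3, k4]

/-- `T_4(4, H_2) ⪰ 0`: `x* T x` is an explicit `LDLᵀ` sum of five hermitian squares with the positive rational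
weights `3, 35/12, 387/140, 112/43, 14509/7168`. [folklore] -/
theorem windowForm_hQ4_two_posSemidef : (ffWindowForm 4 (frobRoots (hQ4 2)) 4).PosSemidef := by
  rw [windowForm_hQ4_two]
  refine Matrix.PosSemidef.of_dotProduct_mulVec_nonneg ?_ fun x => ?_
  · refine Matrix.IsHermitian.ext fun i j => ?_
    fin_cases i <;> fin_cases j <;> simp
  · have key : star x ⬝ᵥ (!![(3:ℂ), 1 / 2, 3 / 4, 7 / 8, 25 / 16; 1 / 2, 3, 1 / 2, 3 / 4, 7 / 8;
        3 / 4, 1 / 2, 3, 1 / 2, 3 / 4; 7 / 8, 3 / 4, 1 / 2, 3, 1 / 2; 25 / 16, 7 / 8, 3 / 4, 1 / 2, 3] *ᵥ x) =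
        3 * (conj (x 0 + 1 / 6 * x 1 + 1 / 4 * x 2 + 7 / 24 * x 3 + 25 / 48 * x 4) *
          (x 0 + 1 / 6 * x 1 + 1 / 4 * x 2 + 7 / 24 * x 3 + 25 / 48 * x 4)) +
        35 / 12 * (conj (x 1 + 9 / 70 * x 2 + 29 / 140 * x 3 + 59 / 280 * x 4) *
          (x 1 + 9 / 70 * x 2 + 29 / 140 * x 3 + 59 / 280 * x 4)) +
        387 / 140 * (conj (x 2 + 19 / 258 * x 3 + 157 / 1548 * x 4) * (x 2 + 19 / 258 * x 3 + 157 / 1548 * x 4)) +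
        112 / 43 * (conj (x 3 - 107 / 2688 * x 4) * (x 3 - 107 / 2688 * x 4)) +
        14509 / 7168 * (conj (x 4) * (x 4)) := by
      simp only [map_add, map_sub, map_mul, map_div₀, map_ofNat]
      simp [dotProduct, Matrix.mulVec, Fin.sum_univ_five]
      ring
    rw [key]
    have h0 := star_mul_self_nonneg (x 0 + 1 / 6 * x 1 + 1 / 4 * x 2 + 7 / 24 * x 3 + 25 / 48 * x 4)
    have h1 := star_mul_self_nonneg (x 1 + 9 / 70 * x 2 + 29 / 140 * x 3 + 59 / 280 * x 4)
    have h2 := star_mul_self_nonneg (x 2 + 19 / 258 * x 3 + 157 / 1548 * x 4)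
    have h3 := star_mul_self_nonneg (x 3 - 107 / 2688 * x 4)
    have h4 := star_mul_self_nonneg (x 4)
    simp only [Complex.star_def] at h0 h1 h2 h3 h4
    have c0 : (0:ℂ) ≤ 3 := by exact_mod_cast Complex.zero_le_real.2 (by norm_num : (0:ℝ) ≤ 3)
    have e1 : ((35 / 12 : ℝ) : ℂ) = 35 / 12 := by push_cast; ring
    have c1 : (0:ℂ) ≤ 35 / 12 := by rw [← e1]; exact Complex.zero_le_real.2 (by norm_num)
    have e2 : ((387 / 140 : ℝ) : ℂ) = 387 / 140 := by push_cast; ring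
    have c2 : (0:ℂ) ≤ 387 / 140 := by rw [← e2]; exact Complex.zero_le_real.2 (by norm_num)
    have e3 : ((112 / 43 : ℝ) : ℂ) = 112 / 43 := by push_cast; ring
    have c3 : (0:ℂ) ≤ 112 / 43 := by rw [← e3]; exact Complex.zero_le_real.2 (by norm_num)
    have e4 : ((14509 / 7168 : ℝ) : ℂ) = 14509 / 7168 := by push_cast; ring
    have c4 : (0:ℂ) ≤ 14509 / 7168 := by rw [← e4]; exact Complex.zero_le_real.2 (by norm_num)
    exact add_nonneg (add_nonneg (add_nonneg (add_nonneg (mul_nonneg c0 h0) (mul_nonneg c1 h1))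
      (mul_nonneg c2 h2)) (mul_nonneg c3 h3)) (mul_nonneg c4 h4)

/-- SHARPNESS WITNESS AT `g = 3`, `q = 4`: `H_2` is monic, FE-honest, RH-false, `deg = 6 = 2g`, its window of
depth `4 = 2g - 2` is positive semidefinite and the one of depth `5 = 2g - 1` is not. [folklore] -/
theorem sharp_witness_q4_two :
    (hQ4 2).Monic ∧
    (frobRoots (hQ4 2)).map (fun α => ((4 : ℝ) : ℂ) / α) = frobRoots (hQ4 2) ∧
    (0 : ℂ) ∉ frobRoots (hQ4 2) ∧ (hQ4 2).natDegree = 2 * 3 ∧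
    ¬ (∀ α ∈ frobRoots (hQ4 2), ‖α‖ = Real.sqrt 4) ∧
    (weilWindowForm 4 (hQ4 2) 4).PosSemidef ∧ ¬ (weilWindowForm 4 (hQ4 2) 5).PosSemidef := by
  have hrec := frobRoots_hQ4_reciprocal 2 le_rfl
  have h0 := zero_not_mem_frobRoots_hQ4 2 le_rfl
  have hoff := exists_offCircle_hQ4 2 le_rfl
  refine ⟨hQ4_monic 2 le_rfl, hrec, h0, by rw [natDegree_hQ4 2 le_rfl], ?_, ?_, ?_⟩
  · intro hall; obtain ⟨α, hα, hne⟩ := hoff; exact hne (hall α hα)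
  · rw [weilWindowForm]; exact windowForm_hQ4_two_posSemidef
  · exact weilWindowForm_not_posSemidef_of_offCircle (by norm_num) hrec h0 hoff
      (by rw [natDegree_hQ4 2 le_rfl])

/-! ## `g = 1`: `h₁ = (x - 1)(x - 4)` -/

/-- The `g = 1` datum at `q = 4`: `h₁ = x² - 5x + 4 = (x - 1)(x - 4)`. [folklore] -/
def hOne : ℤ[X] := X ^ 2 - 5 * X + 4

/-- `h₁` is monic. [folklore] -/
theorem hOne_monic : hOne.Monic := by
  unfold hOne; monicity <;> norm_num

/-- `h₁ = (x - 1)(x - 4)` over `ℂ`. [folklore] -/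
theorem map_hOne : hOne.map (Int.castRingHom ℂ) = ((({1, 4} : Multiset ℂ)).map fun w => X - C w).prod := by
  simp only [hOne, Multiset.insert_eq_cons, Multiset.map_cons, Multiset.map_singleton, Multiset.prod_cons,
    Multiset.prod_singleton, Polynomial.map_add, Polynomial.map_sub, Polynomial.map_mul, Polynomial.map_pow,
    Polynomial.map_X, Polynomial.map_ofNat, map_one, map_ofNat]
  ring

/-- `frobRoots h₁ = {1, 4}`. [folklore] -/
theorem frobRoots_hOne : frobRoots hOne = {1, 4} := by
  unfold frobRoots
  rw [map_hOne, roots_multiset_prod_X_sub_C]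

/-- `deg h₁ = 2`. [folklore] -/
theorem natDegree_hOne : hOne.natDegree = 2 := by
  rw [← card_frobRoots_eq_natDegree, frobRoots_hOne]; simp

/-- SHARPNESS WITNESS AT `g = 1`, `q = 4`: `h₁` is monic, FE-honest (`4/1 = 4`, `4/4 = 1`), RH-false
(`|1| ≠ 2`), `deg = 2`, `T_0 = (1) ⪰ 0` and `T_1` is not PSD. [folklore] -/
theorem sharp_witness_q4_zero :
    hOne.Monic ∧
    (frobRoots hOne).map (fun α => ((4 : ℝ) : ℂ) / α) = frobRoots hOne ∧
    (0 : ℂ) ∉ frobRoots hOne ∧ hOne.natDegree = 2 * 1 ∧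
    ¬ (∀ α ∈ frobRoots hOne, ‖α‖ = Real.sqrt 4) ∧
    (weilWindowForm 4 hOne 0).PosSemidef ∧ ¬ (weilWindowForm 4 hOne 1).PosSemidef := by
  have hrec : (frobRoots hOne).map (fun α => ((4 : ℝ) : ℂ) / α) = frobRoots hOne := by
    rw [frobRoots_hOne]
    simp only [Multiset.insert_eq_cons, Multiset.map_cons, Multiset.map_singleton]
    push_cast
    rw [div_one, div_self (four_ne_zero : (4:ℂ) ≠ 0)]
    exact Multiset.cons_swap _ _ _
  have h0 : (0 : ℂ) ∉ frobRoots hOne := by rw [frobRoots_hOne]; simp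
  have hoff : ∃ α ∈ frobRoots hOne, ‖α‖ ≠ Real.sqrt 4 := by
    refine ⟨1, by rw [frobRoots_hOne]; simp, ?_⟩
    rw [Literature.NumberTheory.EllipticCurves.sqrt_four]; norm_num
  refine ⟨hOne_monic, hrec, h0, by rw [natDegree_hOne], ?_, ?_, ?_⟩
  · intro hall; obtain ⟨α, hα, hne⟩ := hoff; exact hne (hall α hα)
  · rw [weilWindowForm]
    refine Matrix.PosSemidef.of_dotProduct_mulVec_nonneg ?_ fun x => ?_
    · refine Matrix.IsHermitian.ext fun i j => ?_
      fin_cases i; fin_cases j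
      simp [ffWindowForm, ffKernel_zero, frobRoots_hOne]
    · have hT : ffWindowForm 4 (frobRoots hOne) 0 = !![(1:ℂ)] := by
        ext m m'
        fin_cases m; fin_cases m'
        simp [ffWindowForm, Nat.dist, ffKernel_zero, frobRoots_hOne]
      rw [hT]
      have h1 := star_mul_self_nonneg (x 0)
      simp only [Complex.star_def] at h1
      have key : star x ⬝ᵥ (!![(1:ℂ)] *ᵥ x) = conj (x 0) * x 0 := by
        simp [dotProduct, Matrix.mulVec]
      rw [key]; exact h1
  · exact weilWindowForm_not_posSemidef_of_offCircle (by norm_num) hrec h0 hoff (by rw [natDegree_hOne])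

/-! ## All `g ≥ 1` at the one prime power `q = 4` -/

/-- SHARPNESS OF THE POSITIVITY DEPTH, UNIFORMLY IN `g`, AT THE FIXED PRIME POWER `q = 4`: for every `g ≥ 1`
a MONIC FE-honest integer polynomial of degree `2g`, RH-false at `q = 4`, whose window of depth `2g - 2` is
positive semidefinite while depth `2g - 1` is not.  Witnesses: `h₁`, `h♯` (monic by the landed `hSharp_monic`), `H_2`, and `H_{g-1}` (`g ≥ 4`).
[folklore] -/
theorem positivityDepth_sharp_q4 (g : ℕ) (hg : 1 ≤ g) :
    ∃ h : ℤ[X], h.Monic ∧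
      (frobRoots h).map (fun α => ((4 : ℝ) : ℂ) / α) = frobRoots h ∧ (0 : ℂ) ∉ frobRoots h ∧
      h.natDegree = 2 * g ∧ ¬ (∀ α ∈ frobRoots h, ‖α‖ = Real.sqrt 4) ∧
      (weilWindowForm 4 h (2 * g - 2)).PosSemidef ∧ ¬ (weilWindowForm 4 h (2 * g - 1)).PosSemidef := by
  rcases Nat.lt_or_ge g 4 with hlt | hge
  · interval_cases g
    · exact ⟨hOne, sharp_witness_q4_zero⟩
    · obtain ⟨h1, h2, h3, h4, h5, h6⟩ := sharp_witness
      exact ⟨hSharp, hSharp_monic, h1, h2, h3, h4, h5, h6⟩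
    · exact ⟨hQ4 2, sharp_witness_q4_two⟩
  · obtain ⟨d, rfl⟩ : ∃ d, g = d + 1 := ⟨g - 1, by omega⟩
    obtain ⟨hm, h1, h2, h3, h4, h5, h6⟩ := sharp_witness_q4 d (by omega)
    refine ⟨hQ4 d, hm, h1, h2, h3, h4, ?_, ?_⟩
    · rw [show 2 * (d + 1) - 2 = 2 * d by omega]; exact h5
    · rw [show 2 * (d + 1) - 1 = 2 * d + 1 by omega]; exact h6

/-- BOUNDED `q` (the rider's quantifier shape, cf. `positivityDepth_sharp`): `∃ Q₀ (= 4) ∀ g ≥ 1` a sharpness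
witness `(q, h)` with `0 < q ≤ Q₀` — here even with the single value `q = 4` and `h` monic. [folklore] -/
theorem positivityDepth_sharp_bounded (g : ℕ) (hg : 1 ≤ g) :
    ∃ (q : ℕ) (h : ℤ[X]), 0 < q ∧ q ≤ 4 ∧ h.Monic ∧
      (frobRoots h).map (fun α => ((q : ℝ) : ℂ) / α) = frobRoots h ∧ (0 : ℂ) ∉ frobRoots h ∧
      h.natDegree = 2 * g ∧ ¬ (∀ α ∈ frobRoots h, ‖α‖ = Real.sqrt q) ∧
      (weilWindowForm q h (2 * g - 2)).PosSemidef ∧ ¬ (weilWindowForm q h (2 * g - 1)).PosSemidef := by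
  obtain ⟨h, hm, h1, h2, h3, h4, h5, h6⟩ := positivityDepth_sharp_q4 g hg
  refine ⟨4, h, by norm_num, le_rfl, hm, ?_, h2, h3, ?_, ?_, ?_⟩ <;> push_cast <;> assumption

end Summit.RiemannHypothesis.RiemannHypothesis.Theorems.PfPersistence.FfAngleTwin

end
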